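import Summits.QuantumFields.YangMills.Theorems.BalabanUVNodesN18CombStepNearIdentityC0
import Summits.QuantumFields.YangMills.Theorems.BalabanUVNodesN18TransportOfRecordCovariance
import Literature.MathematicalPhysics.QuantumFieldTheory.Balaban1983to89.T4TermwiseBCH
import HarnessLib

/-!
# N18 (β)-transport letters: the C⁰ comb letter, COVARIANT form — any unitary gauge in which the factor `U` is near the identity

[DAGN18W3-G4 INTENT-9, file (9c)] — count-neutral helper toward K3⁷ `stmt-QuantumFields-20544` (NOT claimed, NOT closed).  YM mass gap (Clay) NOT proved by any of
this; R4 closes the conditional finite-𝕋⁴ rung `BalabanLadder.UV` only.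

(9b) `norm_potential_add_combGrad_le` is stated for a factorised NEAR-IDENTITY field `S = (exp iηA)·U₀`.  Run B's pair is `𝐔 = (exp iηA′)·U` with `U ∈ SU(N)` small only
MODULO GAUGE ((1.11): small plaquettes).  This file transports (9b) along an arbitrary bi-contractive (`U1`, e.g. `SU(N)`-valued) gauge transformation `u` of the fine
torus: `𝐔^u = (exp iη·Ad(u)A′)·U^u` EXACTLY (`gaugeU_factors`: `u e^{X} u⁻¹ = e^{uXu⁻¹}`), the (0.4) average is EXACTLY covariant (`avgUnits_gaugeU`, this lane's FILE
`…TransportOfRecordCovariance`; no smallness), `log(uXu⁻¹) = u(log X)u⁻¹` (`B7Prop1Explicit.mlog_units_conj`), and conjugation by `u` is an isometry on the letters.  RESULT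
★★★★ `norm_potential_add_combGrad_le_covariant`: if `U^u` is within `t` of `1` on all bonds (the unitary axial gauge of [Balaban1985Averaging] p. 24 does this on a box with
`t = R·α₀η²`; cut-offs make it global), then the potential `(iξ)⁻¹ log(Ū(𝐔)(c)Ū(U)(c)⁻¹)` of the transported pair, corrected by the conjugated comb gradient
`(η∕ξ)·Ad(u(emb c₋)⁻¹)(λ̄_{Ad(u)A′}(c₊) − λ̄_{Ad(u)A′}(c₋))`, has norm `≤ (η∕ξ)·L·a + R∕ξ` — leading coefficient `ηL∕ξ = 1` on the `α₁`-radius.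
* `gaugeU_factors`, `norm_adJ_le_of_U1`, `avgUnits_mul_inv_gaugeU` (`Ū(𝐔^u)Ū(U^u)⁻¹ = u₋·Ū(𝐔)Ū(U)⁻¹·u₋⁻¹`), `norm_avgUnits_quot_sub_one_le` (`‖Ū(S)Ū(U₀)⁻¹ − 1‖ ≤ 68ℓ(s+t)`),
  ★★★★ the covariant letter (`T4TermwiseBCH.norm_units_conj_le` by name).
What is NOT here (successor, COMB-STEP-DESIGN.md): the choice of `u` (axial gauge of the cut-off factor) with its `t = Rα₀η²`, the comb generator `l` as a definition on
run-A sites and FILE 7's exact `hrest` tuple, the C¹ letter.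

0 `def`, 0 `sorry`.  References: T. Bałaban, CMP **98** (1985) 17–51 [Balaban1985Averaging] ((8), (11) p.19, (21)–(23) p.21, (62)–(63) p.28, (122)–(126) p.36, p.24);
CMP **109** (1987) [Balaban1987RG1] ((0.4), (0.6) p.253, (1.10)–(1.13) p.262).
-/

noncomputable section

open scoped BigOperators Matrix.Norms.L2Operator
open NormedSpace

namespace YMDAG.N18.TransportOfRecord

open Complex (I)
open Literature.MathematicalPhysics.QuantumFieldTheory.Balaban1983to89
open Literature.MathematicalPhysics.QuantumFieldTheory.Balaban1983to89.T4Continuum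
open Literature.MathematicalPhysics.QuantumFieldTheory.Balaban1983to89.BlockAveraging
open Literature.MathematicalPhysics.QuantumFieldTheory.Balaban1983to89.BlockAveragingEMLLinearised (linAvg combMean)
open Literature.MathematicalPhysics.QuantumFieldTheory.Balaban1983to89.B12RegularSpaces111 (expI gaugeU adJ)
open Literature.MathematicalPhysics.QuantumFieldTheory.Balaban1983to89.B12Lemma4Concrete (val_expI)
open Literature.MathematicalPhysics.QuantumFieldTheory.Balaban1983to89.MatrixLog (mlog)
open Literature.MathematicalPhysics.QuantumFieldTheory.Balaban1983to89.B7Prop1Explicit (U1 mem_U1 mlog_units_conj)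
open Literature.MathematicalPhysics.QuantumFieldTheory.Balaban1983to89.T4TermwiseBCH (norm_units_conj_le)
open Literature.MathematicalPhysics.QuantumFieldTheory.Balaban1983to89.Node00.W1 (avgUnits)
open Summit.QuantumFields.YangMills.Theorems.Prop8Chart (norm_emlAvgU_sub_one_sub_linAvg_le)

/-! ## §1 Exact covariance of the factorisation, of the average, of the logarithm -/

section Covariance

variable {P : Params} {j : ℕ} {𝔸 : Type*} [NormedRing 𝔸] [NormedAlgebra ℂ 𝔸] [CompleteSpace 𝔸] [NormOneClass 𝔸]

omit [NormOneClass 𝔸] in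
/-- **The factorisation is exactly covariant**: `(e^{iηA}·U)^u = e^{iη·Ad(u)A}·U^u` bondwise (`u e^{X} u⁻¹ = e^{uXu⁻¹}`). [cite: Balaban1987RG1, (1.10)-(1.11) p.262] -/
theorem gaugeU_factors {η : ℝ} {Uc U : PBond P j → 𝔸ˣ} {A : PBond P j → 𝔸} (hf : ∀ b, Uc b = expI η (A b) * U b) (u : Site P j → 𝔸ˣ) (b : PBond P j) :
    gaugeU u Uc b = expI η (adJ u A b) * gaugeU u U b := by
  have hexp : expI η (adJ u A b) = u b.src * expI η (A b) * (u b.src)⁻¹ := by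
    apply Units.ext
    rw [Units.val_mul, Units.val_mul, val_expI, val_expI]
    show exp ((I * (η : ℂ)) • (((u b.src : 𝔸ˣ) : 𝔸) * A b * (((u b.src)⁻¹ : 𝔸ˣ) : 𝔸))) = _
    rw [← smul_mul_assoc, ← mul_smul_comm,
      Literature.MathematicalPhysics.QuantumLattice.exp_conj_eq_of_mul_eq_one (Units.mul_inv (u b.src)) (Units.inv_mul (u b.src))]
  rw [hexp]
  unfold gaugeU
  rw [hf b]
  group

omit [NormedAlgebra ℂ 𝔸] [CompleteSpace 𝔸] in
/-- `|Ad(u)A| ≤ |A|` for bi-contractive `u`. [cite: Balaban1987RG1, (1.10) p.262] -/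
theorem norm_adJ_le_of_U1 {u : Site P j → 𝔸ˣ} (hu : ∀ x, u x ∈ U1 𝔸) {A : PBond P j → 𝔸} {a : ℝ} (hA : ∀ b, ‖A b‖ ≤ a) (b : PBond P j) :
    ‖adJ u A b‖ ≤ a :=
  (norm_units_conj_le (hu b.src) (A b)).trans (hA b)

omit [NormOneClass 𝔸] in
/-- **The average is exactly covariant, read on the quotient of the two averages**: `Ū(𝐔^u)(c)·Ū(U^u)(c)⁻¹ = u(emb c₋)·[Ū(𝐔)(c)Ū(U)(c)⁻¹]·u(emb c₋)⁻¹`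
(`avgUnits_gaugeU`). [cite: Balaban1985Averaging, (11) p.19] -/
theorem avgUnits_mul_inv_gaugeU (u : Site P j → 𝔸ˣ) (Uc U : PBond P j → 𝔸ˣ) (c : PBond P (j + 1)) :
    avgUnits (gaugeU u Uc) c * (avgUnits (gaugeU u U) c)⁻¹ = u (emb c.src) * (avgUnits Uc c * (avgUnits U c)⁻¹) * (u (emb c.src))⁻¹ := by
  rw [avgUnits_gaugeU, avgUnits_gaugeU]
  simp only [gaugeU, mul_inv_rev, inv_inv]
  group

end Covariance

/-! ## §2 The covariant C⁰ comb letter -/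

section Letter

variable {P : Params} {j : ℕ} {n : Type*} [Fintype n] [DecidableEq n] [Nonempty n]

/-- `‖Ū(S)(c)·Ū(U₀)(c)⁻¹ − 1‖ ≤ 68ℓ(s + t)` for near-identity `S`, `U₀` (`‖S − 1‖ ≤ s`, `‖U₀ − 1‖ ≤ t` on all bonds, `48ℓs, 48ℓt ≤ 1`):
`Ū(S)Ū(U₀)⁻¹ − 1 = (Ū(S) − Ū(U₀))Ū(U₀)⁻¹`, `‖Ū(·) − 1‖ ≤ 17ℓ(·)`, `‖Ū(U₀)⁻¹‖ ≤ 2`. [cite: Balaban1985Averaging, Prop. 3 (122)-(125) p.36] -/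
theorem norm_avgUnits_quot_sub_one_le (hj : j + 1 ≤ P.m + P.K) {S U₀ : GaugeField P j (Matrix n n ℂ)ˣ} {s t : ℝ} (hs0 : 0 ≤ s) (ht0 : 0 ≤ t)
    (hSb : ∀ b, ‖((S b : (Matrix n n ℂ)ˣ) : Matrix n n ℂ) - 1‖ ≤ s) (hU : ∀ b, ‖((U₀ b : (Matrix n n ℂ)ˣ) : Matrix n n ℂ) - 1‖ ≤ t)
    (h48s : 48 * (((P.d + 2) * P.L : ℕ) : ℝ) * s ≤ 1) (h48t : 48 * (((P.d + 2) * P.L : ℕ) : ℝ) * t ≤ 1) (c : PBond P (j + 1)) :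
    ‖((avgUnits S c : (Matrix n n ℂ)ˣ) : Matrix n n ℂ) * (((avgUnits U₀ c)⁻¹ : (Matrix n n ℂ)ˣ) : Matrix n n ℂ) - 1‖ ≤
      68 * (((P.d + 2) * P.L : ℕ) : ℝ) * (s + t) := by
  set ℓ : ℝ := (((P.d + 2) * P.L : ℕ) : ℝ) with hℓdef
  have hℓ0 : 0 ≤ ℓ := Nat.cast_nonneg _
  obtain ⟨-, hX2⟩ := norm_emlAvgU_sub_one_sub_linAvg_le hj (S := S) c hs0 h48s (fun b _ _ => hSb b)
  obtain ⟨-, hY2⟩ := norm_emlAvgU_sub_one_sub_linAvg_le hj (S := U₀) c ht0 h48t (fun b _ _ => hU b)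
  set A : Matrix n n ℂ := ((avgUnits S c : (Matrix n n ℂ)ˣ) : Matrix n n ℂ) with hA
  set B : Matrix n n ℂ := ((avgUnits U₀ c : (Matrix n n ℂ)ˣ) : Matrix n n ℂ) with hB
  set Binv : Matrix n n ℂ := (((avgUnits U₀ c)⁻¹ : (Matrix n n ℂ)ˣ) : Matrix n n ℂ) with hBinv
  change ‖A - 1‖ ≤ _ at hX2
  change ‖B - 1‖ ≤ _ at hY2
  obtain ⟨hBi1, -⟩ := norm_units_inv_le_of_norm_sub_one_le (u := avgUnits U₀ c) hY2 (by nlinarith [mul_nonneg hℓ0 ht0])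
  change ‖Binv‖ ≤ 2 at hBi1
  have hBB : B * Binv = 1 := by rw [hB, hBinv, Units.mul_inv]
  have hid : A * Binv - 1 = (A - B) * Binv := by rw [sub_mul, hBB]
  have hAB : ‖A - B‖ ≤ 17 * ℓ * (s + t) := by
    have : A - B = (A - 1) - (B - 1) := by abel
    rw [this]; exact (norm_sub_le _ _).trans (by linarith)
  rw [hid]
  exact (norm_mul_le _ _).trans (by nlinarith [norm_nonneg (A - B), mul_le_mul hAB hBi1 (norm_nonneg _) (by positivity)])

/-- ★★★★ **THE C⁰ COMB LETTER, COVARIANT FORM.**  Let `𝐔 = (exp iηA′)·U` bondwise (run B's factorisation (1.11)), `|A′| ≤ a` on all bonds, and let `u` be ANY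
bi-contractive (`U1`, e.g. `SU(N)`-valued) gauge transformation of the fine torus such that `‖U^u(b) − 1‖ ≤ t` on all bonds.  With `Ã′ = Ad(u)A′` (`adJ u A′`),
`ηa ≤ 1∕2`, `136ℓ(s + t) ≤ 1` (`s = 2ηa + t + 2ηa·t`), `ξ > 0`:
`‖(iξ)⁻¹ log(Ū(𝐔)(c)·Ū(U)(c)⁻¹) + (η∕ξ)·u(emb c₋)⁻¹(λ̄_{Ã′}(c₊) − λ̄_{Ã′}(c₋))u(emb c₋)‖ ≤ (η∕ξ)·L·a + R∕ξ` with (9a)'s second-order `R` — the potential of the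
transported pair relative to the averaged factor, corrected by the (conjugated, linearised) comb gauge transformation, is bounded with LEADING COEFFICIENT `ηL∕ξ` (`= 1`
at `ξ = Lη`) on the `α₁`-radius. (9b) in the gauge `u` + exact covariance of factorisation, average and logarithm + isometry of `Ad(u)`.
[cite: Balaban1985Averaging, (11) p.19, (21)-(23) p.21, Prop. 3 (62)-(63) p.28, (122)-(126) p.36, p.24; Balaban1987RG1, (0.4) p.253, (1.10)-(1.13) p.262] -/
theorem norm_potential_add_combGrad_le_covariant (hj : j + 1 ≤ P.m + P.K) {Uc U : GaugeField P j (Matrix n n ℂ)ˣ} {A : PBond P j → Matrix n n ℂ}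
    {η ξ a t : ℝ} (hη : 0 ≤ η) (hξ : 0 < ξ) (hf : ∀ b, Uc b = expI η (A b) * U b) (ha0 : 0 ≤ a) (hA : ∀ b, ‖A b‖ ≤ a) (hηa : η * a ≤ 1 / 2) (ht0 : 0 ≤ t)
    {u : Site P j → (Matrix n n ℂ)ˣ} (hu : ∀ x, u x ∈ U1 (Matrix n n ℂ))
    (hU : ∀ b, ‖((gaugeU u U b : (Matrix n n ℂ)ˣ) : Matrix n n ℂ) - 1‖ ≤ t)
    (hℓ : 136 * (((P.d + 2) * P.L : ℕ) : ℝ) * ((2 * (η * a) + t + 2 * (η * a) * t) + t) ≤ 1) (c : PBond P (j + 1)) :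
    ‖(I * (ξ : ℂ))⁻¹ • mlog (((avgUnits Uc c : (Matrix n n ℂ)ˣ) : Matrix n n ℂ) * (((avgUnits U c)⁻¹ : (Matrix n n ℂ)ˣ) : Matrix n n ℂ)) +
        ((η / ξ : ℝ) : ℂ) • ((((u (emb c.src))⁻¹ : (Matrix n n ℂ)ˣ) : Matrix n n ℂ) *
          (combMean (adJ u A) c.tgt - combMean (adJ u A) c.src) * ((u (emb c.src) : (Matrix n n ℂ)ˣ) : Matrix n n ℂ))‖ ≤
      η / ξ * ((P.L : ℝ) * a) +
      (4 * (34 * (((P.d + 2) * P.L : ℕ) : ℝ) * ((2 * (η * a) + t + 2 * (η * a) * t) + t)) ^ 2 +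
        578 * (((P.d + 2) * P.L : ℕ) : ℝ) ^ 2 * ((2 * (η * a) + t + 2 * (η * a) * t) + t) * t +
        660 * (((P.d + 2) * P.L : ℕ) : ℝ) ^ 2 * ((2 * (η * a) + t + 2 * (η * a) * t) ^ 2 + t ^ 2) +
        3 * (((P.d + 2) * P.L : ℕ) : ℝ) * (2 * (η * a) * t) + 3 * (((P.d + 2) * P.L : ℕ) : ℝ) * (η * a) ^ 2) / ξ := by
  -- the gauge-transformed fields
  set S : GaugeField P j (Matrix n n ℂ)ˣ := gaugeU u Uc with hSdef
  set U₀ : GaugeField P j (Matrix n n ℂ)ˣ := gaugeU u U with hU₀def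
  have hS : ∀ b, S b = expI η (adJ u A b) * U₀ b := fun b => gaugeU_factors hf u b
  have hA' : ∀ b, ‖adJ u A b‖ ≤ a := norm_adJ_le_of_U1 hu hA
  -- (9b) in the gauge `u`
  have h9 := norm_potential_add_combGrad_le hj hη hξ hS ha0 hA' hηa ht0 hU hℓ c
  -- the quotient of the averages is conjugated by `u(emb c₋)`
  set v : (Matrix n n ℂ)ˣ := u (emb c.src) with hv
  set X : Matrix n n ℂ := ((avgUnits Uc c : (Matrix n n ℂ)ˣ) : Matrix n n ℂ) * (((avgUnits U c)⁻¹ : (Matrix n n ℂ)ˣ) : Matrix n n ℂ) with hX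
  have hquot : ((avgUnits S c : (Matrix n n ℂ)ˣ) : Matrix n n ℂ) * (((avgUnits U₀ c)⁻¹ : (Matrix n n ℂ)ˣ) : Matrix n n ℂ) =
      (v : Matrix n n ℂ) * X * ((v⁻¹ : (Matrix n n ℂ)ˣ) : Matrix n n ℂ) := by
    rw [hX, ← Units.val_mul, hSdef, hU₀def, avgUnits_mul_inv_gaugeU, Units.val_mul, Units.val_mul, Units.val_mul]
  -- `‖X − 1‖ < 1` (from the near-identity gauge)
  have he : ∀ b, ‖((expI η (adJ u A b) : (Matrix n n ℂ)ˣ) : Matrix n n ℂ) - 1‖ ≤ 2 * (η * a) := fun b =>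
    (norm_coe_expI_sub_one_le hη ((mul_le_mul_of_nonneg_left (hA' b) hη).trans (by linarith))).trans (by nlinarith [hA' b])
  have hSb : ∀ b, ‖((S b : (Matrix n n ℂ)ˣ) : Matrix n n ℂ) - 1‖ ≤ 2 * (η * a) + t + 2 * (η * a) * t := fun b => by
    rw [hS b, Units.val_mul]
    have hid : ((expI η (adJ u A b) : (Matrix n n ℂ)ˣ) : Matrix n n ℂ) * ((U₀ b : (Matrix n n ℂ)ˣ) : Matrix n n ℂ) - 1 =
        (((expI η (adJ u A b) : (Matrix n n ℂ)ˣ) : Matrix n n ℂ) - 1) * (((U₀ b : (Matrix n n ℂ)ˣ) : Matrix n n ℂ) - 1) +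
          ((((expI η (adJ u A b) : (Matrix n n ℂ)ˣ) : Matrix n n ℂ) - 1) + (((U₀ b : (Matrix n n ℂ)ˣ) : Matrix n n ℂ) - 1)) := by noncomm_ring
    rw [hid]
    calc _ ≤ ‖(((expI η (adJ u A b) : (Matrix n n ℂ)ˣ) : Matrix n n ℂ) - 1) * (((U₀ b : (Matrix n n ℂ)ˣ) : Matrix n n ℂ) - 1)‖ +
          ‖(((expI η (adJ u A b) : (Matrix n n ℂ)ˣ) : Matrix n n ℂ) - 1) + (((U₀ b : (Matrix n n ℂ)ˣ) : Matrix n n ℂ) - 1)‖ := norm_add_le _ _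
      _ ≤ 2 * (η * a) * t + (2 * (η * a) + t) := add_le_add ((norm_mul_le _ _).trans (mul_le_mul (he b) (hU b) (norm_nonneg _) (by positivity)))
          ((norm_add_le _ _).trans (add_le_add (he b) (hU b)))
      _ = _ := by ring
  have hnear : ‖((avgUnits S c : (Matrix n n ℂ)ˣ) : Matrix n n ℂ) * (((avgUnits U₀ c)⁻¹ : (Matrix n n ℂ)ˣ) : Matrix n n ℂ) - 1‖ < 1 := by
    have hℓ0 : (0 : ℝ) ≤ (((P.d + 2) * P.L : ℕ) : ℝ) := Nat.cast_nonneg _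
    have hs'0 : 0 ≤ 2 * (η * a) + t + 2 * (η * a) * t := by positivity
    have h := norm_avgUnits_quot_sub_one_le hj (S := S) (U₀ := U₀) hs'0 ht0 hSb hU
      (by nlinarith [mul_nonneg hℓ0 ht0]) (by nlinarith [mul_nonneg hℓ0 hs'0]) c
    exact lt_of_le_of_lt h (by nlinarith [mul_nonneg hℓ0 ht0, mul_nonneg hℓ0 hs'0])
  have hX1 : ‖X - 1‖ < 1 := by
    have hXc : X = ((v⁻¹ : (Matrix n n ℂ)ˣ) : Matrix n n ℂ) * (((avgUnits S c : (Matrix n n ℂ)ˣ) : Matrix n n ℂ) *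
        (((avgUnits U₀ c)⁻¹ : (Matrix n n ℂ)ˣ) : Matrix n n ℂ)) * (((v⁻¹)⁻¹ : (Matrix n n ℂ)ˣ) : Matrix n n ℂ) := by
      rw [hquot, inv_inv]; simp only [← mul_assoc, Units.inv_mul, one_mul]; rw [mul_assoc, Units.inv_mul, mul_one]
    have hsub : X - 1 = ((v⁻¹ : (Matrix n n ℂ)ˣ) : Matrix n n ℂ) * (((avgUnits S c : (Matrix n n ℂ)ˣ) : Matrix n n ℂ) *
        (((avgUnits U₀ c)⁻¹ : (Matrix n n ℂ)ˣ) : Matrix n n ℂ) - 1) * (((v⁻¹)⁻¹ : (Matrix n n ℂ)ˣ) : Matrix n n ℂ) := by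
      rw [mul_sub, sub_mul, mul_one, Units.mul_inv, ← hXc]
    rw [hsub]
    exact lt_of_le_of_lt (norm_units_conj_le ((U1 _).inv_mem (hu _)) _) hnear
  -- the logarithm is covariant
  have hlog : mlog (((avgUnits S c : (Matrix n n ℂ)ˣ) : Matrix n n ℂ) * (((avgUnits U₀ c)⁻¹ : (Matrix n n ℂ)ˣ) : Matrix n n ℂ)) =
      (v : Matrix n n ℂ) * mlog X * ((v⁻¹ : (Matrix n n ℂ)ˣ) : Matrix n n ℂ) := by
    rw [hquot]; exact mlog_units_conj (hu _) hX1
  -- conjugate the whole letter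
  rw [hlog] at h9
  have hconj : (I * (ξ : ℂ))⁻¹ • ((v : Matrix n n ℂ) * mlog X * ((v⁻¹ : (Matrix n n ℂ)ˣ) : Matrix n n ℂ)) +
      ((η / ξ : ℝ) : ℂ) • (combMean (adJ u A) c.tgt - combMean (adJ u A) c.src) =
      (v : Matrix n n ℂ) * ((I * (ξ : ℂ))⁻¹ • mlog X + ((η / ξ : ℝ) : ℂ) • (((v⁻¹ : (Matrix n n ℂ)ˣ) : Matrix n n ℂ) *
        (combMean (adJ u A) c.tgt - combMean (adJ u A) c.src) * (v : Matrix n n ℂ))) * ((v⁻¹ : (Matrix n n ℂ)ˣ) : Matrix n n ℂ) := by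
    rw [mul_add, add_mul, mul_smul_comm, smul_mul_assoc, mul_smul_comm, smul_mul_assoc]
    congr 2
    simp only [← mul_assoc, Units.mul_inv, one_mul]; rw [mul_assoc, Units.mul_inv, mul_one]
  rw [hconj] at h9
  -- `‖Y‖ = ‖v⁻¹ (v Y v⁻¹) v‖ ≤ ‖v Y v⁻¹‖`
  set Y := (I * (ξ : ℂ))⁻¹ • mlog X + ((η / ξ : ℝ) : ℂ) • (((v⁻¹ : (Matrix n n ℂ)ˣ) : Matrix n n ℂ) *
    (combMean (adJ u A) c.tgt - combMean (adJ u A) c.src) * (v : Matrix n n ℂ)) with hY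
  have hback : Y = ((v⁻¹ : (Matrix n n ℂ)ˣ) : Matrix n n ℂ) * ((v : Matrix n n ℂ) * Y * ((v⁻¹ : (Matrix n n ℂ)ˣ) : Matrix n n ℂ)) *
      (((v⁻¹)⁻¹ : (Matrix n n ℂ)ˣ) : Matrix n n ℂ) := by
    rw [inv_inv]; simp only [← mul_assoc, Units.inv_mul, one_mul]; rw [mul_assoc, Units.inv_mul, mul_one]
  rw [hback]
  exact (norm_units_conj_le ((U1 _).inv_mem (hu _)) _).trans h9

end Letter

end YMDAG.N18.TransportOfRecord

end
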